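import Literature.AnabelianGeometry.EtaleTheta.BiKummerRoots
import HarnessLib

/-!
# [EtTh] Proposition 4.2 (ii), (iii), (iv): sub-DAG statements file `Prop42Sub`

Mochizuki, *The étale theta function and its Frobenioid-theoretic manifestations*, Publ. RIMS **45**
(2009), §4, Proposition 4.2 "Construction of Bi-Kummer Data I: Roots of Fraction-Pairs", statement PDF
pp. 88–89 (printed 314–315), proof pp. 89–90 (printed 315–316) [cite: MochizukiEtTh2009, Prop 4.2 p.88].

STATEMENTS-FIRST file of the sub-DAG `plan/L2/SUBDAG-EtTh-Prop42.md` (abc-iut cell, D-0068 (1); dag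
SUBDAG-WANTED v0 rows `EtTh:Prop4.2(ii)`, `EtTh:Prop4.2(iii)`; writer abc-iut-w5-d134): the intermediate
statements of the PRINTED PROOF of Prop. 4.2 (iii) (existence of `N`-th roots of fraction-pairs) and (iv)
(isomorphisms between two `N`-th roots) as NAMED `Prop`s over abc-iut-L2-t3's §4 setting
`S : BiKummerSetting X T D VD` (`BiKummer.lean`: Def. 4.1; `BiKummerRoots.lean`: the typed targets
`BiKummerSetting.Prop42_iii`, `BiKummerSetting.Prop42_iv` and the data `NthRoot`), together with the
PROVED compositions `prop42_iii_of_subnodes`, `prop42_iv_of_subnodes` (the sub-nodes close the typed nodes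
by pure logic, kernel-checked). Prop. 4.2 (i), (ii) are already DISCHARGED modulo [FrdI] facts by
abc-iut-L6-t12 (`Discharge/Sec4FractionPairs.lean`, `Discharge/Sec4Prop42.lean`: `prop42_i_of`,
`prop42_ii_of`; model instance `prop42_ii_mkOfModel`, `Discharge/Sec4Model.lean`) — their proof steps are
listed in the `.md` with those FQNs and are not re-typed here.

Reading of the printed proof of (iii) (PDF p.89 L76 – p.90 L11; `Lnn` = line of the lit render paper:doi-10-2977-prims-1234361159 p00NN.txt):
«by the definition of "log-meromorphic" [Def. 3.1 (ii)], … over some tempered covering of `X^log` … `f`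
admits an `N`-th root» (= `RootOverCovering`; ERRATUM E2: this sentence uses condition (a)
"tempered-meromorphic" of [IUTchI] Rmk. 3.2.4 (i), the author's Comments on [EtTh] (i)–(iv) — IUT's
approach (A), cf. `TemperedCoverings.lean` `LogDivisorModel.temperedMero`); «since … `Φ` is assumed to be
perfect, … the divisors of zeroes and poles of such an `N`-th root belong to `Φ(−)`» + «[FrdI], Definition
1.3, (iii), (d) [on the existence of pre-steps with prescribed zero divisor]» (= `RootFractionPair`);
«[FrdII], Remark 2.2.1 [concerning the issue of "(N, H_⊙^{bs-fld})-saturation"]» (= `SaturatedRefinement`);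
«since the Frobenioid `C` is of model … type [cf. Theorem 3.7, (i)], it follows that `C` admits a
base-Frobenius pair [cf. [FrdI], Definition 2.7, (iii)]» (= `BaseFrobeniusLift`); «the existence of a pair of
commutative diagrams as in the statement of assertion (iii) follows by translating the above
"scheme-theoretic observations" into the language of Frobenioids» (= `RootSquares`). Proof of (iv) (p.90
L12–24): WLOG `δ = id` (the typed `Prop42_iv` is already the `δ = id` case); «the existence of a `ζ_A` …
follows … from the uniqueness up to conjugation by a unit of base-Frobenius pairs of `A_N`, `Ā_N` [[FrdI]
Prop. 5.6], by thinking of `α'', ᾱ''` as categorical quotients [Rmk. 4.1.1] and applying the base-triviality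
and `Aut`-ampleness of the full subcategory of `C` determined by the Frobenius-trivial objects [[FrdI] Thm.
5.1 (iii)]», with the `N`-th roots of pulled-back units supplied by «the "(N, H_⊙, f|_{A_N})-saturated-ness"
condition … [cf. also Proposition 3.4, (ii)]» (= `UnitRootsUpstairs`, `ZetaA`); «the existence of a `ζ_B` …
follows from the equivalences of categories determined by pre-steps of [FrdI], Definition 1.3, (iii), (d)»
(= `ZetaB`, with the `μ_N(B_N)`-ambiguity «after possibly replacing `s''_N` by `u ∘ s''_N`» of the statement);
`β = β̄ ∘ ζ_B` by total epimorphicity (= `BetaCompat`); «the essential uniqueness of `ζ_A, ζ_B` … follows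
immediately from the various conditions» (= `ZetaB_unique`, `ZetaA_unique_upto_mu`, typed, not consumed by
the composition since `Prop42_iv` renders the existence clause).

Conventions: multiplicative monoids (`N · a` is `a ^ N`), diagrammatic composition (`s' ∘ α` is
`α ≫ s'`); `pullFrac` = the transport `((α')^birat)^* : O^×(A^birat) → O^×(A_N^birat)` along a
(pull-back) morphism ([FrdI] Prop. 1.11 (iv)), an explicit parameter exactly as in `Prop42_iii`/`Prop42_iv`
(for the model: abc-iut-L2-t9's `pullFracModel`, `BiKummerOfModel.lean`). Every `def` below is a `Prop`
quantified over the setting — a predicate, asserted by nobody; the undischarged ones are the wave-5 board's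
targets (`EtTh:Prop4.2(iii)/L01a …`). No new named fact about a published result is introduced: each
sub-statement is an intermediate statement OF THE PRINTED PROOF at the cited lines, over existing
vocabulary. Typed ≠ proved; nothing here takes a side on [IUTchIII] Cor. 3.12.
-/

namespace Literature.AnabelianGeometry.EtaleTheta

open CategoryTheory Opposite Literature.AlgebraicGeometry.Frobenioids

universe u₀ v₀ u v w

variable {K : Type u₀} [Field K]

namespace BiKummerSetting

variable {X : SemiGraphs.TemperedArithmeticGroup.{u₀} K} {D₀ : Type u₀} [Category.{v₀} D₀]
  {V : FrdIMonoidStub.{w}} {T : RealifiedDivisorMonoids (D₀ := D₀) V} {D : Type u} [Category.{v} D]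
  {VD : FrdICatStub.{u, v, w} D} (S : BiKummerSetting X T D VD)

namespace Prop42Sub

/-! ## A. Proposition 4.2 (iii) — existence of an `N`-th root of a fraction-pair (proof p.89 l.33 – p.90 l.7) -/

/-- **(iii)/L01a `RootOverCovering`** (p.89 L77–80): «by the definition of "log-meromorphic" [cf.
Definition 3.1, (ii)], it follows immediately that over some tempered covering of `X^log` that occurs as
the "universal combinatorial covering" of a finite étale covering of `X^log` with stable, split reduction,
`f` admits an `N`-th root» — ERRATUM E2: with Def. 3.1 (ii) read as condition (a) of [IUTchI] Rmk. 3.2.4 (i)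
(IUT's approach (A)). Frobenioid-level rendering: the covering is an object `A'` of `C` with a pull-back
morphism `φ : A' → A_⊙` ([FrdI] Def. 1.3 (i)), chosen Frobenius-trivial, Galois and `μ_N`-saturated
([FrdII] Def. 2.1 (i): enlarge the covering), and the root is `g ∈ O^×(A'^birat)` with `g^N = f|_{A'}`.
[cite: MochizukiEtTh2009, Prop 4.2 p.89] -/
def RootOverCovering
    (pullFrac : ∀ {A A' : S.C} (_ : A' ⟶ A), S.biratUnits A → S.biratUnits A') : Prop :=
  ∀ (N : ℕ+) (f : S.biratUnits S.Aodot), ∃ (A' : S.C) (φ : A' ⟶ S.Aodot),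
    S.IsPullback φ ∧ S.IsFrobeniusTrivial A' ∧ S.IsGalois A' ∧ S.IsMuSaturated A' N ∧
      ∃ g : S.biratUnits A', g ^ (N : ℕ) = pullFrac φ f

/-- **(iii)/L01b `SaturatedRefinement`** (p.90 L10–11 with p.88 (iii) «`A_N` is `(N, H_⊙, f|_{A_N})`-saturated»):
«[FrdII], Remark 2.2.1 [concerning the issue of "(N, H_⊙^{bs-fld})-saturation"]» — a covering carrying an
`N`-th root of `f` may be refined (pull-back morphism `ψ : A'' → A'`) to one whose domain is
`(N, H_⊙, f|_{A''})`-saturated in the sense of Def. 4.1 (iii) (`IsSaturated`: `H_⊙`-ample, `f|_{A''}` fixed by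
`H_{A''}` [because `f` comes from `A_⊙` and `H_⊙` acts trivially on `A_⊙^bs`], (a) the `(N, H_⊙^{bs-fld})`-saturated
Frobenius-trivial object, (b) the root), keeping the properties of L01a. [cite: MochizukiEtTh2009, Prop 4.2 p.90] -/
def SaturatedRefinement
    (pullFrac : ∀ {A A' : S.C} (_ : A' ⟶ A), S.biratUnits A → S.biratUnits A') : Prop :=
  ∀ (N : ℕ+) (f : S.biratUnits S.Aodot) (A' : S.C) (φ : A' ⟶ S.Aodot),
    S.IsPullback φ → S.IsFrobeniusTrivial A' → S.IsGalois A' → S.IsMuSaturated A' N →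
    (∃ g : S.biratUnits A', g ^ (N : ℕ) = pullFrac φ f) →
      ∃ (A'' : S.C) (ψ : A'' ⟶ A'), S.IsPullback (ψ ≫ φ) ∧ S.IsFrobeniusTrivial A'' ∧
        S.IsGalois A'' ∧ S.IsMuSaturated A'' N ∧ S.IsSaturated A'' N (pullFrac (ψ ≫ φ) f)

/-- **(iii)/L01 `SaturatedRootCover`** = L01a followed by L01b (the form the composition consumes): for
every `N` and `f ∈ O^×(A_⊙^birat)` there is a pull-back morphism `φ : A_N → A_⊙` from a Frobenius-trivial,
Galois, `μ_N`-saturated object `A_N` which is `(N, H_⊙, f|_{A_N})`-saturated (in particular `f|_{A_N}` has an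
`N`-th root in `O^×(A_N^birat)`, Def. 4.1 (iii)(b)). [cite: MochizukiEtTh2009, Prop 4.2 p.89] -/
def SaturatedRootCover
    (pullFrac : ∀ {A A' : S.C} (_ : A' ⟶ A), S.biratUnits A → S.biratUnits A') : Prop :=
  ∀ (N : ℕ+) (f : S.biratUnits S.Aodot), ∃ (A' : S.C) (φ : A' ⟶ S.Aodot),
    S.IsPullback φ ∧ S.IsFrobeniusTrivial A' ∧ S.IsGalois A' ∧ S.IsMuSaturated A' N ∧
      S.IsSaturated A' N (pullFrac φ f)

/-- L01a and L01b give L01 (pure logic). [cite: MochizukiEtTh2009, Prop 4.2 p.89] -/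
theorem saturatedRootCover_of
    {pullFrac : ∀ {A A' : S.C} (_ : A' ⟶ A), S.biratUnits A → S.biratUnits A'}
    (h₁ : RootOverCovering S pullFrac) (h₂ : SaturatedRefinement S pullFrac) :
    SaturatedRootCover S pullFrac := by
  intro N f
  obtain ⟨A', φ, hφ, hft, hgal, hmu, hg⟩ := h₁ N f
  obtain ⟨A'', ψ, hψφ, hft', hgal', hmu', hsat⟩ := h₂ N f A' φ hφ hft hgal hmu hg
  exact ⟨A'', ψ ≫ φ, hψφ, hft', hgal', hmu', hsat⟩

/-- **(iii)/L02 `RootFractionPair`** (p.89 L80–83 + p.90 L6–10): «since, moreover, the divisor monoid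
`Φ` is assumed to be perfect, it follows that the divisors of zeroes and poles of such an `N`-th root belong
to `Φ(−)` of the tempered covering in question» and «[FrdI], Definition 1.3, (iii), (d) [on the existence of
pre-steps with prescribed zero divisor]» — Frobenioid-level rendering: an `N`-th root `g` of `f|_{A'}`
(along a pull-back morphism `φ : A' → A_⊙`) is computed by a fraction-pair `(s'_N, s''_N) : A' → B_N`
(Def. 4.1 (i): base-equivalent pre-steps with disjoint supports and `s'_N · (s''_N)⁻¹ = g`) whose zero
divisor and divisor of poles are the `N`-th roots in `Φ(A'^bs)` of the pull-backs of `Div(s')`, `Div(s'')`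
(supports: [FrdI] Prop. 4.1 (iii); the dictionary `Div_B(s' · (s'')⁻¹) = Div(s') − Div(s'')`: [FrdI] Thm.
5.2 (ii)). [cite: MochizukiEtTh2009, Prop 4.2 p.89] -/
def RootFractionPair
    (pullFrac : ∀ {A A' : S.C} (_ : A' ⟶ A), S.biratUnits A → S.biratUnits A') : Prop :=
  ∀ {B : S.C} (f : S.biratUnits S.Aodot) (P : S.FractionPair f B) (N : ℕ+) (A' : S.C)
    (φ : A' ⟶ S.Aodot) (g : S.biratUnits A'), S.IsPullback φ → g ^ (N : ℕ) = pullFrac φ f →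
      ∃ (BN : S.C) (Q : S.FractionPair g BN),
        S.div Q.num ^ (N : ℕ) = pull S.tf.divisorMonoid (ModelFrobenioid.baseMap φ) (S.div P.num) ∧
          S.div Q.den ^ (N : ℕ) = pull S.tf.divisorMonoid (ModelFrobenioid.baseMap φ) (S.div P.den)

/-- **(iii)/L03 `BaseFrobeniusLift`** (p.89 L83 – p.90 L6, with Def. 4.1 (iv)): «since the Frobenioid `C`
is of model [hence, in particular, pre-model] type [cf. Theorem 3.7, (i)], it follows that `C` admits a
base-Frobenius pair [cf. [FrdI], Definition 2.7, (iii)]» — hence, for a Frobenius-trivial, Galois,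
`μ_N`-saturated `A'` and a pull-back morphism `φ : A' → A_⊙`, the base-Frobenius pair supplies the
base-identity endomorphism of Frobenius type `α''` of degree `N` and the subgroup `G` ([FrdI] Prop. 5.6),
i.e. data "of base-Frobenius type" (Def. 4.1 (iv) (a)–(e)) for the isometry `α := α'' ≫ φ` of Frobenius
degree `N` with pull-back part `α' = φ`.  **Finding F-w4d044-1 (L2-lead ruling 2026-08-26): AS TYPED
(`d.α₁ = φ` for a GIVEN `φ`) this is false at every model with a non-trivial unit of `A_⊙`**
(`Discharge/Sec4Prop42SubBaseLiftNegative.lean`; [FrdI] Def. 2.7 (i): a base-section is a skeleton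
equivalent to `D`, so no unit `≠ 1` is `P`-distinguished) — SUPERSEDED by L03′ `BaseFrobeniusLiftUpToUnit`
below; kept for the record. [cite: MochizukiEtTh2009, Prop 4.2 p.89] -/
def BaseFrobeniusLift : Prop :=
  ∀ (N : ℕ+) (A' : S.C) (φ : A' ⟶ S.Aodot), S.IsPullback φ → S.IsFrobeniusTrivial A' →
    S.IsGalois A' → S.IsMuSaturated A' N →
      ∃ (α : A' ⟶ S.Aodot) (d : S.BaseFrobeniusTypeData α), d.α₁ = φ ∧ S.IsIsometry α ∧ S.degFr α = N

/-- **(iii)/L04 `RootSquares`** (p.90 L6–9): «the existence of a pair of commutative diagrams as in the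
statement of assertion (iii) follows by translating the above "scheme-theoretic observations" into the
language of Frobenioids — cf. [FrdI], Definition 1.3, (iii), (d)» (and the factorisation (iv)(a); `f|_{A_N} =
((α')^birat)^*(f)`, [FrdI] Prop. 1.11 (iv)): given `α : A_N → A_⊙` of base-Frobenius type (isometry of
Frobenius degree `N`, pull-back part `α'`), an `N`-th root `g` of `((α')^birat)^* f` and a fraction-pair
`(s'_N, s''_N) : A_N → B_N` for `g` with `N · Div(s'_N) = (α')^* Div(s')`, `N · Div(s''_N) = (α')^* Div(s'')`,
there is an isometry `β : B_N → B` of Frobenius degree `N` with `s' ∘ α = β ∘ s'_N` and `s'' ∘ α = β ∘ s''_N`.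
[cite: MochizukiEtTh2009, Prop 4.2 p.90] -/
def RootSquares
    (pullFrac : ∀ {A A' : S.C} (_ : A' ⟶ A), S.biratUnits A → S.biratUnits A') : Prop :=
  ∀ {B : S.C} (f : S.biratUnits S.Aodot) (P : S.FractionPair f B) (N : ℕ+) (A' : S.C)
    (α : A' ⟶ S.Aodot) (d : S.BaseFrobeniusTypeData α) (g : S.biratUnits A') (BN : S.C)
    (Q : S.FractionPair g BN), S.IsIsometry α → S.degFr α = N → g ^ (N : ℕ) = pullFrac d.α₁ f →
      S.div Q.num ^ (N : ℕ) = pull S.tf.divisorMonoid (ModelFrobenioid.baseMap d.α₁) (S.div P.num) →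
      S.div Q.den ^ (N : ℕ) = pull S.tf.divisorMonoid (ModelFrobenioid.baseMap d.α₁) (S.div P.den) →
        ∃ β : BN ⟶ B, S.IsIsometry β ∧ S.degFr β = N ∧ Q.num ≫ β = α ≫ P.num ∧ Q.den ≫ β = α ≫ P.den

/-- **Composition for Prop. 4.2 (iii)**: the sub-nodes L01 (= L01a + L01b), L02, L03, L04 give the typed
node `BiKummerSetting.Prop42_iii` ("there exist commutative diagrams … an `N`-th root of the fraction-pair")
by pure logic — the `N`-domain is the saturated covering object of L01, `α` the base-Frobenius-type lift of
L03, the root and its fraction-pair from Def. 4.1 (iii)(b) and L02, `β` from L04. PROVED.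
[cite: MochizukiEtTh2009, Prop 4.2 p.88] -/
theorem prop42_iii_of_subnodes
    {pullFrac : ∀ {A A' : S.C} (_ : A' ⟶ A), S.biratUnits A → S.biratUnits A'}
    (h₁ : SaturatedRootCover S pullFrac) (h₂ : RootFractionPair S pullFrac)
    (h₃ : BaseFrobeniusLift S) (h₄ : RootSquares S pullFrac) : S.Prop42_iii pullFrac := by
  intro B f P N
  obtain ⟨A', φ, hφ, hft, hgal, hmu, hsat⟩ := h₁ N f
  obtain ⟨g, hg⟩ := hsat.cond_b
  obtain ⟨α, d, hd, hiso, hdeg⟩ := h₃ N A' φ hφ hft hgal hmu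
  obtain ⟨BN, Q, hQn, hQd⟩ := h₂ f P N A' φ g hφ hg
  subst hd
  obtain ⟨β, hβiso, hβdeg, hcn, hcd⟩ := h₄ f P N A' α d g BN Q hiso hdeg hg hQn hQd
  exact ⟨{
    AN := A'
    BN := BN
    α := α
    β := β
    root := g
    pair := Q
    comm_num := hcn
    comm_den := hcd
    isIsometry := ⟨hiso, hβiso, hdeg, hβdeg⟩
    αData := d
    pow_root := hg
    isSaturated := hsat }⟩

/-- The same composition from the finer cut L01a, L01b, L02, L03, L04. PROVED.
[cite: MochizukiEtTh2009, Prop 4.2 p.88] -/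
theorem prop42_iii_of_subnodes'
    {pullFrac : ∀ {A A' : S.C} (_ : A' ⟶ A), S.biratUnits A → S.biratUnits A'}
    (h₁ : RootOverCovering S pullFrac) (h₁' : SaturatedRefinement S pullFrac)
    (h₂ : RootFractionPair S pullFrac) (h₃ : BaseFrobeniusLift S) (h₄ : RootSquares S pullFrac) :
    S.Prop42_iii pullFrac :=
  prop42_iii_of_subnodes S (saturatedRootCover_of S h₁ h₁') h₂ h₃ h₄

/-! ## B. Proposition 4.2 (iv) — isomorphisms between two `N`-th roots (proof p.90 l.8–24) -/

section PartIV

variable (pullFrac : ∀ {A A' : S.C} (_ : A' ⟶ A), S.biratUnits A → S.biratUnits A')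

/-- **(iv)/L05 `UnitRootsUpstairs`** (p.90 L14–17): «it follows from the "(N, H_⊙, f|_{A_N})-saturated-ness"
condition in the statement of assertion (iii) [cf. also Proposition 3.4, (ii)] that the pull-back
`∈ O^×(A_N)` or `∈ O^×(Ā_N)` of any element `∈ O^×(A_⊙)` [i.e., via the "pull-back portion" of `α, ᾱ` —
cf. Definition 4.1, (iv), (d)] admits an `N`-th root»: every unit of the `N`-domain `A_N` lying over a unit of
`A_⊙` along the pull-back part `α'` of `α` is an `N`-th power in `O^×(A_N)` (the ingredient of L06 that
adjusts the base-Frobenius pairs by a unit). [cite: MochizukiEtTh2009, Prop 4.2 p.90] -/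
def UnitRootsUpstairs : Prop :=
  ∀ {B : S.C} (f : S.biratUnits S.Aodot) (P : S.FractionPair f B) (N : ℕ+)
    (R : S.NthRoot f P N pullFrac) (x : Aut S.Aodot) (x' : Aut R.AN), x ∈ S.units S.Aodot →
    x' ∈ S.units R.AN → x'.hom ≫ R.αData.α₁ = R.αData.α₁ ≫ x.hom →
      ∃ y ∈ S.units R.AN, y ^ (N : ℕ) = x'

/-- **(iv)/L06 `ZetaA`** (p.90 L17–21): «the existence of a `ζ_A` as desired follows immediately from the
uniqueness up to conjugation by a unit of base-Frobenius pairs of `A_N`, `Ā_N` [cf. [FrdI], Proposition 5.6],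
by thinking of `α'', ᾱ''` as categorical quotients [cf. Remark 4.1.1] and applying the base-triviality and
`Aut`-ampleness of the full subcategory of `C` determined by the Frobenius-trivial objects [cf. [FrdI],
Theorem 5.1, (iii)]» (the unit being adjusted by L05): for two `N`-th roots of the same fraction-pair and a
base isomorphism `Ā' : A_N^bs ⥲ Ā_N^bs` with `ᾱ^bs ∘ Ā' = α^bs`, there is `ζ_A : A_N ⥲ Ā_N` in `C` with
`α = ᾱ ∘ ζ_A` and `ζ_A^bs = Ā'`. [cite: MochizukiEtTh2009, Prop 4.2 p.90] -/
def ZetaA : Prop :=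
  ∀ {B : S.C} (f : S.biratUnits S.Aodot) (P : S.FractionPair f B) (N : ℕ+)
    (R R' : S.NthRoot f P N pullFrac) (ebs : S.base.obj R.AN ≅ S.base.obj R'.AN),
    S.base.map R.α = ebs.hom ≫ S.base.map R'.α →
      ∃ ζA : R.AN ≅ R'.AN, ζA.hom ≫ R'.α = R.α ∧ S.base.mapIso ζA = ebs

/-- **(iv)/L07 `ZetaB`** (p.90 L21–23 with the statement p.89 L1–8): «the existence of a `ζ_B` as desired
follows from the equivalences of categories determined by pre-steps of [FrdI], Definition 1.3, (iii), (d)»,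
«after possibly replacing `s''_N` by `u ∘ s''_N`, for some `u ∈ μ_N(B_N)`»: given `ζ_A` over `α, ᾱ`, there are
`u ∈ μ_N(B_N)` and `ζ_B : B_N ⥲ B̄_N` with `s̄'_N ∘ ζ_A = ζ_B ∘ s'_N` and `s̄''_N ∘ ζ_A = ζ_B ∘ u ∘ s''_N`
(ingredients in print: `N · Div(s'_N) = α^* Div(s')` and torsion-freeness of `Φ`, cf.
`Discharge/Sec4RootDivisors.lean`; the two fractions have the same `N`-th power).
[cite: MochizukiEtTh2009, Prop 4.2 p.90] -/
def ZetaB : Prop :=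
  ∀ {B : S.C} (f : S.biratUnits S.Aodot) (P : S.FractionPair f B) (N : ℕ+)
    (R R' : S.NthRoot f P N pullFrac) (ζA : R.AN ≅ R'.AN), ζA.hom ≫ R'.α = R.α →
      ∃ (u : S.mu R.BN N) (ζB : R.BN ≅ R'.BN),
        ζA.hom ≫ R'.pair.num = R.pair.num ≫ ζB.hom ∧
          ζA.hom ≫ R'.pair.den = (R.pair.den ≫ (u : Aut R.BN).hom) ≫ ζB.hom

/-- **(iv)/L08 `BetaCompat`** (statement p.89 L8 «`β = β̄ ∘ ζ_B`»; proof: both `β` and `β̄ ∘ ζ_B` complete the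
square over `s'_N` with `s' ∘ α = s' ∘ ᾱ ∘ ζ_A`, and pre-steps are epimorphisms — «Frobenioids are always
totally epimorphic», [FrdI] Def. 1.3 (v)): [cite: MochizukiEtTh2009, Prop 4.2 p.89] -/
def BetaCompat : Prop :=
  ∀ {B : S.C} (f : S.biratUnits S.Aodot) (P : S.FractionPair f B) (N : ℕ+)
    (R R' : S.NthRoot f P N pullFrac) (ζA : R.AN ≅ R'.AN) (ζB : R.BN ≅ R'.BN),
    ζA.hom ≫ R'.α = R.α → ζA.hom ≫ R'.pair.num = R.pair.num ≫ ζB.hom → ζB.hom ≫ R'.β = R.β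

/-- **Composition for Prop. 4.2 (iv)**: L06, L07, L08 give the typed node `BiKummerSetting.Prop42_iv` by
pure logic (L05 is an ingredient OF L06 in print and is listed for the board, not consumed here). PROVED.
[cite: MochizukiEtTh2009, Prop 4.2 p.89] -/
theorem prop42_iv_of_subnodes (h₆ : ZetaA S pullFrac) (h₇ : ZetaB S pullFrac)
    (h₈ : BetaCompat S pullFrac) : S.Prop42_iv pullFrac := by
  intro B f P N R R' ebs hebs
  obtain ⟨ζA, hα, hbs⟩ := h₆ f P N R R' ebs hebs
  obtain ⟨u, ζB, hnum, hden⟩ := h₇ f P N R R' ζA hα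
  exact ⟨u, ζA, ζB, hnum, hden, hα, h₈ f P N R R' ζA ζB hα hnum, hbs⟩

/-- **(iv)/U1 `ZetaB_unique`** (p.89 L8–9 «`ζ_B` is uniquely determined by `ζ_A`»; proof p.90 L23–24): two
isomorphisms `B_N ⥲ B̄_N` completing the `s'_N`-square for the same `ζ_A` coincide (pre-steps are
epimorphisms). Typed for the board; not part of the typed `Prop42_iv` (existence clause).
[cite: MochizukiEtTh2009, Prop 4.2 p.89] -/
def ZetaB_unique : Prop :=
  ∀ {B : S.C} (f : S.biratUnits S.Aodot) (P : S.FractionPair f B) (N : ℕ+)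
    (R R' : S.NthRoot f P N pullFrac) (ζA : R.AN ≅ R'.AN) (ζB ζB' : R.BN ≅ R'.BN),
    ζA.hom ≫ R'.pair.num = R.pair.num ≫ ζB.hom → ζA.hom ≫ R'.pair.num = R.pair.num ≫ ζB'.hom →
      ζB = ζB'

/-- **(iv)/U2 `ZetaA_unique_upto_mu`** (p.89 L9–10 «`ζ_A` is uniquely determined by `Ā'`, up to composition
with an element of `μ_N(A_N)`»): two isomorphisms `A_N ⥲ Ā_N` over `α, ᾱ` with the same base isomorphism
differ by an element of `μ_N(A_N)`. Typed for the board; not part of the typed `Prop42_iv`.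
[cite: MochizukiEtTh2009, Prop 4.2 p.89] -/
def ZetaA_unique_upto_mu : Prop :=
  ∀ {B : S.C} (f : S.biratUnits S.Aodot) (P : S.FractionPair f B) (N : ℕ+)
    (R R' : S.NthRoot f P N pullFrac) (ζA ζA' : R.AN ≅ R'.AN),
    ζA.hom ≫ R'.α = R.α → ζA'.hom ≫ R'.α = R.α → S.base.mapIso ζA = S.base.mapIso ζA' →
      ∃ u : S.mu R.AN N, ζA' = (u : Aut R.AN) ≪≫ ζA

/-- **(iv)/L07′ `RootUnitTorsion`** — the residual `μ_N`-clause of L07 («for some `u ∈ μ_N(B_N)`», p.89 L4):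
the unit `u ∈ O^×(B_N)` relating the two denominator squares is `N`-torsion. In print this is the comparison
of the fractions of the two roots (`f_N^N = f|_{A_N}`, `f̄_N^N = f|_{Ā_N}`, [FrdII] Def. 2.1 (i)); it needs the
birational dictionary of [FrdI] Thm. 5.2 (ii) (abstract in `BiKummerSetting`; identity at abc-iut-L2-t9's
`mkOfModel`). [cite: MochizukiEtTh2009, Prop 4.2 p.89] -/
def RootUnitTorsion : Prop :=
  ∀ {B : S.C} (f : S.biratUnits S.Aodot) (P : S.FractionPair f B) (N : ℕ+)
    (R R' : S.NthRoot f P N pullFrac) (ζA : R.AN ≅ R'.AN) (ζB : R.BN ≅ R'.BN) (u : Aut R.BN),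
    u ∈ S.units R.BN → ζA.hom ≫ R'.α = R.α → ζA.hom ≫ R'.pair.num = R.pair.num ≫ ζB.hom →
      ζA.hom ≫ R'.pair.den = (R.pair.den ≫ u.hom) ≫ ζB.hom → u ^ (N : ℕ) = 1

end PartIV

/-! ## A′. Proposition 4.2 (iii) — RESHAPED rows L01′ / L03′ (L2-lead ruling 2026-08-26T03:05Z on finding
F-w4d044-1).  Print CHOOSES the covering object `A_N` and the pull-back part `α'` from the base-Frobenius
pair ([FrdI] Def. 2.7: `P` is a skeleton through `A_⊙`, `α'` THE `P`-arrow over the covering map); a GIVEN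
pull-back morphism `φ` is `P`-distinguished only up to a unit of its domain, and not at all when its domain
is a twist `A' ≠ A_⊙` of `A_⊙` over an isomorphic base.  Hence: L01′ produces the covering inside a
skeleton through `A_⊙`; L03′ lifts up to a unit. -/

section PartIIIprime

variable (pullFrac : ∀ {A A' : S.C} (_ : A' ⟶ A), S.biratUnits A → S.biratUnits A')

/-- **(iii)/L01′ `SaturatedRootCoverInSkeleton`** (p.89 L77 – p.90 L11, as L01, with the harmless
normalisation print makes implicitly — «we may assume without loss of generality that `C` is a skeleton»,
[FrdI] p.102): the saturated root-covering object `A_N → A_⊙` of L01 may be chosen so that `A_N = A_⊙`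
whenever `A_N^bs ≅ A_⊙^bs` (i.e. inside a skeleton of `C` through `A_⊙`).  [cite: MochizukiEtTh2009, Prop 4.2 p.89] -/
def SaturatedRootCoverInSkeleton : Prop :=
  ∀ (N : ℕ+) (f : S.biratUnits S.Aodot), ∃ (A' : S.C) (φ : A' ⟶ S.Aodot),
    (Nonempty (S.base.obj A' ≅ S.base.obj S.Aodot) → A' = S.Aodot) ∧
      S.IsPullback φ ∧ S.IsFrobeniusTrivial A' ∧ S.IsGalois A' ∧ S.IsMuSaturated A' N ∧
        S.IsSaturated A' N (pullFrac φ f)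

/-- L01′ refines L01 (pure logic). [cite: MochizukiEtTh2009, Prop 4.2 p.89] -/
theorem saturatedRootCover_of_inSkeleton (h : SaturatedRootCoverInSkeleton S pullFrac) :
    SaturatedRootCover S pullFrac := by
  intro N f
  obtain ⟨A', φ, -, hφ, hft, hgal, hmu, hsat⟩ := h N f
  exact ⟨A', φ, hφ, hft, hgal, hmu, hsat⟩

/-- **(iii)/L03′ `BaseFrobeniusLiftUpToUnit`** (p.89 L83 – p.90 L6 with Def. 4.1 (iv); the print-faithful
replacement of L03, L2-lead ruling 2026-08-26 on F-w4d044-1): «since the Frobenioid `C` is of model [hence,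
in particular, pre-model] type [cf. Theorem 3.7, (i)], it follows that `C` admits a base-Frobenius pair
[cf. [FrdI], Definition 2.7, (iii)]» — for a Frobenius-trivial, Galois, `μ_N`-saturated `A'` and a pull-back
morphism `φ : A' → A_⊙`, PROVIDED `A'` is not a twist of `A_⊙` over an isomorphic base (`A'^bs ≅ A_⊙^bs`
only if `A' = A_⊙`), there are a unit `s ∈ O^×(A')`, an isometry `α : A' → A_⊙` of Frobenius degree `N`
and data of base-Frobenius type for `α` whose pull-back part is `s ≫ φ` (the `P`-arrow over `Base(φ)`;
`s = 1` can be arranged when `A' ≠ A_⊙`). [cite: MochizukiEtTh2009, Prop 4.2 p.89] -/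
def BaseFrobeniusLiftUpToUnit : Prop :=
  ∀ (N : ℕ+) (A' : S.C) (φ : A' ⟶ S.Aodot),
    (Nonempty (S.base.obj A' ≅ S.base.obj S.Aodot) → A' = S.Aodot) →
      S.IsPullback φ → S.IsFrobeniusTrivial A' → S.IsGalois A' → S.IsMuSaturated A' N →
        ∃ (s : Aut A') (_ : s ∈ S.units A') (α : A' ⟶ S.Aodot) (d : S.BaseFrobeniusTypeData α),
          d.α₁ = s.hom ≫ φ ∧ S.IsIsometry α ∧ S.degFr α = N

/-- **Composition for Prop. 4.2 (iii) along the reshaped rows**: L01′, L02, L03′, L04 give the typed node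
`BiKummerSetting.Prop42_iii`, provided the transport `pullFrac` ("`((α')^birat)^*`", [FrdI] Prop. 1.11
(iv)) does not see units of the domain (`pullFrac (s ≫ φ) = pullFrac φ` for `s ∈ O^×(A')` — units of `A'`
act trivially on `O^×(A'^birat)`; `rfl`-true for abc-iut-L2-t9's `pullFracModel`, which only depends on
`Base`): the root of `f|_{A_N}` and its saturation are the same for `φ` and for the pull-back part
`α' = s ≫ φ`, whose pull-back property is Def. 4.1 (iv)(d). PROVED. [cite: MochizukiEtTh2009, Prop 4.2 p.88] -/
theorem prop42_iii_of_subnodes_upToUnit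
    {pullFrac : ∀ {A A' : S.C} (_ : A' ⟶ A), S.biratUnits A → S.biratUnits A'}
    (hpull : ∀ {A A' : S.C} (φ : A' ⟶ A) (s : Aut A'), s ∈ S.units A' →
      ∀ f : S.biratUnits A, pullFrac (s.hom ≫ φ) f = pullFrac φ f)
    (h₁ : SaturatedRootCoverInSkeleton S pullFrac) (h₂ : RootFractionPair S pullFrac)
    (h₃ : BaseFrobeniusLiftUpToUnit S) (h₄ : RootSquares S pullFrac) : S.Prop42_iii pullFrac := by
  intro B f P N
  obtain ⟨A', φ, hsk, hφ, hft, hgal, hmu, hsat⟩ := h₁ N f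
  obtain ⟨s, hs, α, d, hd, hiso, hdeg⟩ := h₃ N A' φ hsk hφ hft hgal hmu
  have hpf : pullFrac d.α₁ f = pullFrac φ f := by
    rw [hd]
    exact hpull φ s hs f
  have hsat' : S.IsSaturated A' N (pullFrac d.α₁ f) := by simpa only [hpf] using hsat
  obtain ⟨g, hg⟩ := hsat'.cond_b
  obtain ⟨BN, Q, hQn, hQd⟩ := h₂ f P N A' d.α₁ g d.cond_d hg
  obtain ⟨β, hβiso, hβdeg, hcn, hcd⟩ := h₄ f P N A' α d g BN Q hiso hdeg hg hQn hQd
  exact ⟨{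
    AN := A'
    BN := BN
    α := α
    β := β
    root := g
    pair := Q
    comm_num := hcn
    comm_den := hcd
    isIsometry := ⟨hiso, hβiso, hdeg, hβdeg⟩
    αData := d
    pow_root := hg
    isSaturated := hsat' }⟩

end PartIIIprime

end Prop42Sub

end BiKummerSetting

end Literature.AnabelianGeometry.EtaleTheta
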